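import Literature.Probability.Percolation.AdjLocal
import Literature.Probability.Percolation.ArmSeparationOutLandingFour
import Literature.Probability.Percolation.LocallyMonotoneFKG
import HarnessLib

/-!
# The generalised FKG step of the adjacent outer landing (Nolin's Lemma 13)

Topic `Literature/Probability/Percolation`; family `crit-perc` / near-critical percolation on `𝕋`.
A brick of the near-critical arm-separation theorem for four arms in the ADJACENT colour
arrangement (P. Nolin, EJP 13 (2008), Thm. 11, `j = 4`, `σ = BBWW` [arXiv 0711.4948: Thm. 10],
landing step, §4.3 Prop. 12 and Lemma 13, §4.4 p. 12); the adjacent twin of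
`Slot4.real_corrE_ge / real_arms_le / real_biUnion_arms_le` (`ArmSeparationOutLandingFour.lean`).

* `real_corr1_ge_at` — one corridor costs `c^(B+3)` at any density (RSW–Harris, short sides capped);
* `extFourAdjR n N` — two disjoint open arms landed on the sides `0, 1` of `∂Λ_N` and two disjoint
  closed arms landed on the sides `3, 4` (read through `ρ³` of the complement);
* `ASlot.real_corrE_ge`, **`ASlot.real_arms_le`** —
  `P_p(armsE true ∩ armsE false) · (c^(B+3))⁴ ≤ P_p(extFourAdjR n (4M))`
  (`triSitePercolation_locallyMonotone_fkg` with the shared set `suppA true ∪ suppA false` off the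
  corridors, the increasing private set `suppC true` and the decreasing one `suppC false`; the move;
  rotation invariance); `real_biUnion_arms_le` — summed over routed slots.

Everything here is proved; no named facts are introduced.

## References

* P. Nolin, Near-critical percolation in two dimensions, *Electron. J. Probab.* 13 (2008), §4.3
  Prop. 12, Lemma 13, §4.4 (arXiv 0711.4948: Prop. 11, Lemma 12; proof of Thm. 10, p. 12) [Nolin2008].
* H. Kesten, Scaling relations for 2D-percolation, *Comm. Math. Phys.* 109 (1987), Lemma 2, §2 [Kesten1987].
-/

noncomputable section

open Set MeasureTheory

namespace Literature.Probability.Percolation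

open LatticeModels Tube Lanes AdjTipData

/-! ### One corridor at any density -/

/-- **One corridor costs `c^(B+3)` at density `q`**: the spoke (aspect `L ≤ ρ · 2ε`), the arc (at most
`B` ring tubes of aspect `≤ 4`), the approach tube (`W ≤ ρ · N'/64`) and the thinned target free
space, all increasing and local, by RSW at `q` (short sides `≤ Ncap`) and Harris. [cite: Nolin2008, §4.3 Prop. 12 (proof) (arXiv 0711.4948: Prop. 11)] -/
theorem real_corr1_ge_at (q : unitInterval) {c : ℝ} {ρ Ncap : ℕ}
    (hrsw : ∀ n : ℕ, 1 ≤ ⌊(ρ : ℝ) * n⌋₊ → n ≤ Ncap → c ≤ triLRCrossingProb q ⌊(ρ : ℝ) * n⌋₊ n) (hρ : 4 ≤ ρ) (hc : 0 ≤ c)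
    {i M k : ℕ} {T₀ : ℤ} {w L ε r e s a len B : ℕ} {t : ℤ} {W N' : ℕ}
    (hε : 1 ≤ ε) (hεcap : 2 * ε ≤ Ncap) (hsp : L ≤ ρ * (2 * ε)) (he : 1 ≤ e) (hecap : 2 * e ≤ Ncap) (hse : s + 2 * e ≤ 4 * (2 * e))
    (hrs : 1 ≤ r / s)
    (hn : 1 ≤ N' / 64) (hncap : N' / 64 ≤ Ncap) (hW : W ≤ ρ * (N' / 64)) (hV : 2 * (N' / 64) ≤ ρ * (N' / 16 - 1)) (hV' : 1 ≤ N' / 16 - 1)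
    (hVcap : N' / 16 - 1 ≤ Ncap) (hlen : (arc (thinRing r e s) a len).length ≤ B) :
    c ^ (B + 3) ≤ (triSitePercolation q).real (corr1 i M k T₀ w L ε r e s a len t W N') := by
  have hρ1 : 1 ≤ ρ := le_trans (by norm_num) hρ
  have hc1 : c ≤ 1 := by
    have h := hrsw 1 (by rw [Nat.cast_one, mul_one, Nat.floor_natCast]; exact hρ1) (le_trans hε (by omega))
    exact h.trans measureReal_le_one
  set E1 := extSpokeEvent i M k T₀ w L ε with hE1
  set E2 := eventAll (arc (thinRing r e s) a len) with hE2
  set E3 : Set (SiteConfig (Site 2)) := triHCross ((r : ℤ) - 2 * e) t W (N' / 64) with hE3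
  set E4 : Set (SiteConfig (Site 2)) := otgtV N' t with hE4
  have d1 : DeterminedBy E1 ↑((extSpokeTube M k T₀ w L ε).sites.image (triRotIsoPow i)) := by
    rw [Finset.coe_image, coe_sites]; exact determinedBy_extSpokeEvent i M k T₀ w L ε
  have d2 : DeterminedBy E2 ↑(sitesAll (arc (thinRing r e s) a len)) := determinedBy_eventAll _
  have d3 : DeterminedBy E3 ↑(triStripFinset ((r : ℤ) - 2 * e) t W (N' / 64)) := determinedBy_triHCross _ _ _ _
  have d4 : DeterminedBy E4 ↑(triStripFinset ((N' : ℤ) + 1) (t - (N' / 64 : ℕ)) (N' / 16 - 1) (2 * (N' / 64))) :=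
    determinedBy_triVCross _ _ _ _
  have u1 : IsUpperSet E1 := isUpperSet_extSpokeEvent i M k T₀ w L ε
  have u2 : IsUpperSet E2 := isUpperSet_eventAll _
  have u3 : IsUpperSet E3 := isUpperSet_triHCross _ _ _ _
  have u4 : IsUpperSet E4 := isUpperSet_triVCross _ _ _ _
  -- the four probabilities
  have p1 : c ≤ (triSitePercolation q).real E1 := by
    rw [hE1, extSpokeEvent, real_preimage_rotConfig]
    refine Tube.le_real_event_at q hrsw hρ1 ?_ ?_
    · simp only [Tube.AspectLE, extSpokeTube, cond_true]; exact ⟨hsp, by omega⟩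
    · simp only [Tube.short, extSpokeTube, cond_true]; exact hεcap
  have p2 : c ^ B ≤ (triSitePercolation q).real E2 := by
    refine le_trans (pow_le_pow_of_le_one hc hc1 hlen) ?_
    refine Tube.pow_le_real_eventAll_at q hrsw hρ1 hc _ fun T hT => ⟨?_, ?_⟩
    · exact (aspectLE_of_mem_thinRing he hse (mem_of_mem_arc hT)).mono hρ
    · rw [short_of_mem_thinRing hrs (mem_of_mem_arc hT)]; exact hecap
  have p3 : c ≤ (triSitePercolation q).real E3 := by
    rw [hE3, show triHCross ((r : ℤ) - 2 * e) t W (N' / 64) = (⟨(r : ℤ) - 2 * e, t, W, N' / 64, true⟩ : Tube).event from rfl]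
    refine Tube.le_real_event_at q hrsw hρ1 ?_ ?_
    · simp only [Tube.AspectLE, cond_true]; exact ⟨hW, hn⟩
    · simp only [Tube.short, cond_true]; exact hncap
  have p4 : c ≤ (triSitePercolation q).real E4 := by
    rw [hE4, show otgtV N' t = (⟨(N' : ℤ) + 1, t - (N' / 64 : ℕ), N' / 16 - 1, 2 * (N' / 64), false⟩ : Tube).event from rfl]
    refine Tube.le_real_event_at q hrsw hρ1 ?_ ?_
    · simp only [Tube.AspectLE, cond_false]; exact ⟨hV, hV'⟩
    · simp only [Tube.short, cond_false]; exact hVcap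
  -- Harris, three times
  have h12 := sitePercolation_harris' q d1 d2 u1 u2
  have d12 : DeterminedBy (E1 ∩ E2) ↑((extSpokeTube M k T₀ w L ε).sites.image (triRotIsoPow i) ∪ sitesAll (arc (thinRing r e s) a len)) := by
    rw [Finset.coe_union]; exact (d1.mono subset_union_left).inter (d2.mono subset_union_right)
  have h123 := sitePercolation_harris' q d12 d3 (u1.inter u2) u3
  have d123 : DeterminedBy (E1 ∩ E2 ∩ E3) ↑(((extSpokeTube M k T₀ w L ε).sites.image (triRotIsoPow i) ∪ sitesAll (arc (thinRing r e s) a len)) ∪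
      triStripFinset ((r : ℤ) - 2 * e) t W (N' / 64)) := by
    rw [Finset.coe_union]; exact (d12.mono subset_union_left).inter (d3.mono subset_union_right)
  have h1234 := sitePercolation_harris' q d123 d4 ((u1.inter u2).inter u3) u4
  unfold triSitePercolation at p1 p2 p3 p4 ⊢
  unfold corr1
  rw [← hE1, ← hE2, ← hE3, ← hE4]
  calc c ^ (B + 3) = c * c ^ B * c * c := by ring
    _ ≤ (sitePercolation (Site 2) q).real E1 * (sitePercolation (Site 2) q).real E2 *
        (sitePercolation (Site 2) q).real E3 * (sitePercolation (Site 2) q).real E4 := by gcongr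
    _ ≤ (sitePercolation (Site 2) q).real (E1 ∩ E2 ∩ E3 ∩ E4) := by
      calc _ ≤ (sitePercolation (Site 2) q).real (E1 ∩ E2) * (sitePercolation (Site 2) q).real E3 *
            (sitePercolation (Site 2) q).real E4 := by gcongr
        _ ≤ (sitePercolation (Site 2) q).real (E1 ∩ E2 ∩ E3) * (sitePercolation (Site 2) q).real E4 := by gcongr
        _ ≤ _ := h1234

/-! ### The landed event -/

/-- **Two disjoint open arms landed on the sides `0, 1` of `∂Λ_N` and two disjoint closed arms landed
on the sides `3, 4`** (the closed pair read as an open pair of `ρ³` of the complement). [cite: Nolin2008, §4.2 Def. 6–8 and §4.4 (arXiv 0711.4948: Def. 6–8; proof of Thm. 10, p. 13), σ = BBWW] -/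
def extFourAdjR (n N : ℕ) : Set (SiteConfig (Site 2)) :=
  {χ | χ ∈ extOpenDuoR n N ∧ rotConfig 3 χᶜ ∈ extOpenDuoR n N}

namespace OParams

variable {P : OParams}

/-- Rings of higher level have more chunks. [folklore] -/
theorem ValidA.nA_le_nA_seven (_hV : P.ValidA) {ℓ : ℕ} (hℓ : ℓ < 8) : P.nA ℓ ≤ P.nA 7 := by
  unfold OParams.nA
  apply Nat.div_le_div_right
  unfold OParams.rL
  have h : (2 * P.M + (2 * ℓ + 1) * P.μ) / P.s ≤ (2 * P.M + (2 * 7 + 1) * P.μ) / P.s :=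
    Nat.div_le_div_right (by nlinarith)
  exact Nat.add_le_add_right (Nat.mul_le_mul_left _ h) _

end OParams

namespace ASlot

variable {P : OParams} {σ : ASlot}

/-- The reading map of the colour `b` changes the density to `p` (open) or `1 - p` (closed) and is
otherwise measure preserving. [folklore] -/
theorem real_preimage_readCfg (p : unitInterval) (σ : ASlot) (b : Bool) (E : Set (SiteConfig (Site 2))) :
    (triSitePercolation p).real {ω | σ.readCfg b ω ∈ E} = (triSitePercolation (if b then p else unitInterval.symm p)).real E := by
  have : {ω | σ.readCfg b ω ∈ E} = (colCfg b) ⁻¹' (rotConfig (σ.rot b) ⁻¹' E) := by ext ω; rfl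
  rw [this]
  cases b
  · have e : (colCfg false) ⁻¹' (rotConfig (σ.rot false) ⁻¹' E) = Compl.compl ⁻¹' (rotConfig (σ.rot false) ⁻¹' E) := by
      ext ω; simp [colCfg_false]
    rw [e]
    simp only [Bool.false_eq_true, ↓reduceIte]
    unfold triSitePercolation
    rw [sitePercolation_real_preimage_compl]
    exact real_preimage_rotConfig _ _ _
  · have e : (colCfg true) ⁻¹' (rotConfig (σ.rot true) ⁻¹' E) = rotConfig (σ.rot true) ⁻¹' E := by ext ω; simp [colCfg_true]
    rw [e]; simp only [↓reduceIte]; exact real_preimage_rotConfig _ _ _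

/-- **The corridors event of the colour `b` has probability at least `(c^(B+3))²` at density `p`.** [cite: Nolin2008, §4.3 Prop. 12 (proof), Lemma 13 (arXiv 0711.4948: Prop. 11, Lemma 12)] -/
theorem real_corrE_ge (hV : P.ValidA) (hR : σ.RouteOK P) (p : unitInterval) {c : ℝ} {ρ Ncap B : ℕ}
    (hrsw : ∀ q : unitInterval, (q = p ∨ q = unitInterval.symm p) →
      ∀ n : ℕ, 1 ≤ ⌊(ρ : ℝ) * n⌋₊ → n ≤ Ncap → c ≤ triLRCrossingProb q ⌊(ρ : ℝ) * n⌋₊ n)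
    (hρ : 64 ≤ ρ) (hc : 0 ≤ c) (hsp : P.LL 7 ≤ ρ * (2 * P.ε)) (hcap : P.N' / 16 ≤ Ncap) (hB : P.GrA 7 ≤ B) (b : Bool) :
    (c ^ (B + 3)) ^ 2 ≤ (triSitePercolation p).real (σ.corrE P b) := by
  obtain ⟨hs, hk₀, hμ, hw1, hw2, he1, he2, hε1, hε2, -, -, -, -, -, -, hN, -, -, hn, hμM, hR₀, hR₀M, -⟩ := hV.toValid.ifacts
  obtain ⟨ea1, ea2, ea3, ea4, ea5, -⟩ := hV.eA_facts
  obtain ⟨hsA, hsA16⟩ := hV.sA_facts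
  have hN4 : P.N' = 4 * P.M := rfl
  set q : unitInterval := if b then p else unitInterval.symm p with hq
  have hq' : q = p ∨ q = unitInterval.symm p := by rw [hq]; split_ifs <;> simp
  -- each of the two corridors
  have hone : ∀ (a : Fin 4) (i : ℕ), c ^ (B + 3) ≤ (triSitePercolation q).real
      (corr1 i P.M (σ.k P a) (σ.T P a) P.w (σ.L P a) P.ε (σ.rE P a) P.eA P.sA (σ.ast a) (σ.aln a) (σ.tr P a) (σ.W P a) P.N') := by
    intro a i
    obtain ⟨hk1, hk2, -, -, -, -, -, -, -, hns, hn1, hGE, r1, r2, r3, hL, hW, -⟩ := efacts hV hR a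
    obtain ⟨ha1, -, ha3⟩ := hR.harc a
    have hsA1 : 1 ≤ P.sA := by omega
    have hns' : σ.nE P a * P.sA = σ.rE P a := by exact_mod_cast hns
    have hq1 : σ.rE P a / P.sA = σ.nE P a := by rw [← hns', Nat.mul_div_cancel _ hsA1]
    have hlen : (arc (thinRing (σ.rE P a) P.eA P.sA) (σ.ast a) (σ.aln a)).length ≤ B := by
      rw [length_arc (by rw [length_thinRing (by rw [hq1]; exact hn1), hq1, ← hGE]; exact ha3)]
      have h7 := hV.nA_le_nA_seven (hR.hlv a)
      have : σ.GE P a ≤ P.GrA 7 := by rw [hGE]; unfold OParams.GrA ASlot.nE at *; omega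
      omega
    have hμ0 : (0 : ℤ) ≤ P.μ := by positivity
    have hl7 : (σ.lv a : ℤ) ≤ 7 := by have := hR.hlv a; omega
    have hμ15 : (2 * (σ.lv a : ℤ) + 1) * P.μ ≤ 15 * P.μ := mul_le_mul_of_nonneg_right (by linarith) hμ0
    have hLL7 : (P.LL 7 : ℤ) = 15 * P.μ + 2 * P.s + 4 * P.e := by unfold OParams.LL; push_cast; ring
    have hsp' : (P.LL 7 : ℤ) ≤ ρ * (2 * P.ε) := by exact_mod_cast hsp
    have hLρ : σ.L P a ≤ ρ * (2 * P.ε) := by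
      have h1 : (σ.L P a : ℤ) ≤ P.LL 7 := by rw [hL, hLL7, hs]; linarith
      have : (σ.L P a : ℤ) ≤ ρ * (2 * P.ε) := h1.trans hsp'
      exact_mod_cast this
    refine real_corr1_ge_at q (hrsw q hq') (by omega) hc (by omega) (by omega) hLρ ea4 (by omega) (by omega) (by rw [hq1]; exact hn1)
      (by omega) (by omega) ?_ ?_ (by omega) (by omega) hlen
    · have hl0 : (0 : ℤ) ≤ σ.lv a := by positivity
      have hμ1 : (P.μ : ℤ) ≤ (2 * σ.lv a + 1) * P.μ := le_mul_of_one_le_left hμ0 (by linarith)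
      have hW' : (σ.W P a : ℤ) ≤ 2 * P.M + (4 * P.M / 16 : ℕ) + 2 * P.eA := by linarith
      have h64 : (4 * (P.M : ℤ)) ≤ 64 * ((4 * P.M / 64 : ℕ) : ℤ) + 63 := by omega
      have h1 : σ.W P a ≤ 64 * (P.N' / 64) := by rw [hN4]; zify; omega
      exact h1.trans (Nat.mul_le_mul_right _ hρ)
    · have hρ' : 2 ≤ ρ := by omega
      calc 2 * (P.N' / 64) ≤ 2 * (P.N' / 16 - 1) := by omega
        _ ≤ ρ * (P.N' / 16 - 1) := Nat.mul_le_mul_right _ hρ'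
  -- the corridors event is a reading preimage of the intersection of two increasing local events
  set C₀ := corr1 (σ.iR b 0) P.M (σ.k P (ex b 0)) (σ.T P (ex b 0)) P.w (σ.L P (ex b 0)) P.ε (σ.rE P (ex b 0)) P.eA P.sA
    (σ.ast (ex b 0)) (σ.aln (ex b 0)) (σ.tr P (ex b 0)) (σ.W P (ex b 0)) P.N' with hC₀
  set C₁ := corr1 ((σ.iR b 1 + 5) % 6) P.M (σ.k P (ex b 1)) (σ.T P (ex b 1)) P.w (σ.L P (ex b 1)) P.ε (σ.rE P (ex b 1)) P.eA P.sA
    (σ.ast (ex b 1)) (σ.aln (ex b 1)) (σ.tr P (ex b 1)) (σ.W P (ex b 1)) P.N' with hC₁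
  have hE : σ.corrE P b = {ω | σ.readCfg b ω ∈ C₀ ∩ rotConfig 1 ⁻¹' C₁} := by ext ω; rfl
  rw [hE, real_preimage_readCfg, ← hq]
  have d0 := determinedBy_corr1 (σ.iR b 0) P.M (σ.k P (ex b 0)) (σ.T P (ex b 0)) P.w (σ.L P (ex b 0)) P.ε (σ.rE P (ex b 0)) P.eA P.sA
    (σ.ast (ex b 0)) (σ.aln (ex b 0)) (σ.tr P (ex b 0)) (σ.W P (ex b 0)) P.N'
  have d1 := determinedBy_preimage_rotConfig 1 (determinedBy_corr1 ((σ.iR b 1 + 5) % 6) P.M (σ.k P (ex b 1)) (σ.T P (ex b 1)) P.w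
    (σ.L P (ex b 1)) P.ε (σ.rE P (ex b 1)) P.eA P.sA (σ.ast (ex b 1)) (σ.aln (ex b 1)) (σ.tr P (ex b 1)) (σ.W P (ex b 1)) P.N')
  rw [← hC₀] at d0; rw [← hC₁] at d1
  -- as finite sets
  have d0' : DeterminedBy C₀ ↑(((extSpokeTube P.M (σ.k P (ex b 0)) (σ.T P (ex b 0)) P.w (σ.L P (ex b 0)) P.ε).sites.image
      (triRotIsoPow (σ.iR b 0))) ∪ σ.farFin P (ex b 0)) := by
    refine d0.mono (le_of_eq ?_)
    rw [Finset.coe_union, Finset.coe_image, coe_sites, coe_farFin]; rfl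
  have d1' : DeterminedBy (rotConfig 1 ⁻¹' C₁) ↑((((extSpokeTube P.M (σ.k P (ex b 1)) (σ.T P (ex b 1)) P.w (σ.L P (ex b 1)) P.ε).sites.image
      (triRotIsoPow ((σ.iR b 1 + 5) % 6))) ∪ σ.farFin P (ex b 1)).image (triRotIsoPow 1)) := by
    refine d1.mono (le_of_eq ?_)
    rw [Finset.coe_image, Finset.coe_union, Finset.coe_image, coe_sites, coe_farFin]; rfl
  have u0 : IsUpperSet C₀ := isUpperSet_corr1 _ _ _ _ _ _ _ _ _ _ _ _ _ _ _
  have u1 : IsUpperSet (rotConfig 1 ⁻¹' C₁) := isUpperSet_preimage_rotConfig 1 (isUpperSet_corr1 _ _ _ _ _ _ _ _ _ _ _ _ _ _ _)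
  have hH := sitePercolation_harris' q d0' d1' u0 u1
  have p0 := hone (ex b 0) (σ.iR b 0)
  have p1 : c ^ (B + 3) ≤ (triSitePercolation q).real (rotConfig 1 ⁻¹' C₁) := by rw [real_preimage_rotConfig]; exact hone (ex b 1) _
  have hq0 : 0 ≤ c ^ (B + 3) := by positivity
  unfold triSitePercolation at p0 p1 ⊢
  calc (c ^ (B + 3)) ^ 2 = c ^ (B + 3) * c ^ (B + 3) := sq _
    _ ≤ (sitePercolation (Site 2) q).real C₀ * (sitePercolation (Site 2) q).real (rotConfig 1 ⁻¹' C₁) :=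
        mul_le_mul p0 p1 hq0 measureReal_nonneg
    _ ≤ _ := hH

/-- The target event pulled back along the rotation `ρ^r`. [folklore] -/
theorem readCfg_mem_extFourAdjR {ω : SiteConfig (Site 2)} {n N : ℕ} (h0 : σ.readCfg true ω ∈ extOpenDuoR n N)
    (h1 : σ.readCfg false ω ∈ extOpenDuoR n N) : rotConfig (σ.r % 6) ω ∈ extFourAdjR n N := by
  have e0 : σ.readCfg true ω = rotConfig (σ.r % 6) ω := by
    show rotConfig (σ.r % 6) (colCfg true ω) = _; rw [colCfg_true]
  rw [e0] at h0
  refine ⟨h0, ?_⟩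
  have e : rotConfig 3 (rotConfig (σ.r % 6) ω)ᶜ = σ.readCfg false ω := by
    show _ = rotConfig ((σ.r + 3) % 6) (colCfg false ω)
    rw [colCfg_false, rotConfig_compl, rotConfig_rotConfig, ← rotConfig_mod_six (3 + σ.r % 6)]
    congr 1; omega
  rw [e]; exact h1

/-- **Nolin's Lemma 13 for a routed slot of the adjacent landing**:
`P_p(armsE true ∩ armsE false) · (c^(B+3))⁴ ≤ P_p(extFourAdjR n (4M))`. [cite: Nolin2008, §4.3 Prop. 12 and Lemma 13 (arXiv 0711.4948: Prop. 11, Lemma 12); §4.4 p. 12 (constants C₁, C₂), σ = BBWW] -/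
theorem real_arms_le (hV : P.ValidA) (hR : σ.RouteOK P) (p : unitInterval) {c : ℝ} {ρ Ncap B : ℕ}
    (hrsw : ∀ q : unitInterval, (q = p ∨ q = unitInterval.symm p) →
      ∀ n : ℕ, 1 ≤ ⌊(ρ : ℝ) * n⌋₊ → n ≤ Ncap → c ≤ triLRCrossingProb q ⌊(ρ : ℝ) * n⌋₊ n)
    (hρ : 64 ≤ ρ) (hc : 0 ≤ c) (hsp : P.LL 7 ≤ ρ * (2 * P.ε)) (hcap : P.N' / 16 ≤ Ncap) (hB : P.GrA 7 ≤ B) :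
    (triSitePercolation p).real (σ.armsE P true ∩ σ.armsE P false) * (c ^ (B + 3)) ^ 4 ≤
      (triSitePercolation p).real (extFourAdjR P.n (4 * P.M)) := by
  classical
  -- the three pairwise disjoint regions of Nolin's Lemma 13
  set Pf := σ.suppC P true with hPf
  set Mf := σ.suppC P false with hMf
  set Sf := (σ.suppA P true ∪ σ.suppA P false) \ (Pf ∪ Mf) with hSf
  have hSP : Disjoint Sf Pf := Finset.disjoint_left.2 fun v hv hv' => (Finset.mem_sdiff.1 hv).2 (Finset.mem_union_left _ hv')
  have hSM : Disjoint Sf Mf := Finset.disjoint_left.2 fun v hv hv' => (Finset.mem_sdiff.1 hv).2 (Finset.mem_union_right _ hv')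
  have hPM : Disjoint Pf Mf := suppC_disjoint_suppC hV hR
  -- supports
  have hAP : (↑(σ.suppA P true) : Set (Site 2)) ⊆ ↑Sf ∪ ↑Pf := by
    intro v hv
    by_cases hP : v ∈ Pf
    · exact Or.inr hP
    · have hM : v ∉ Mf := fun h => Finset.disjoint_left.1 (suppA_disjoint_suppC hV hR true) hv h
      exact Or.inl (Finset.mem_sdiff.2 ⟨Finset.mem_union_left _ hv, fun h => (Finset.mem_union.1 h).elim hP hM⟩)
  have hAM : (↑(σ.suppA P false) : Set (Site 2)) ⊆ ↑Sf ∪ ↑Mf := by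
    intro v hv
    by_cases hM : v ∈ Mf
    · exact Or.inr hM
    · have hP : v ∉ Pf := fun h => Finset.disjoint_left.1 (suppA_disjoint_suppC hV hR false) hv h
      exact Or.inl (Finset.mem_sdiff.2 ⟨Finset.mem_union_right _ hv, fun h => (Finset.mem_union.1 h).elim hP hM⟩)
  have dAp : DeterminedBy (σ.armsE P true) (↑Sf ∪ ↑Pf) := (determinedBy_armsE hV hR true).mono hAP
  have dAm : DeterminedBy (σ.armsE P false) (↑Sf ∪ ↑Mf) := (determinedBy_armsE hV hR false).mono hAM
  have dBp : DeterminedBy (σ.corrE P true) ↑Pf := determinedBy_corrE hR true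
  have dBm : DeterminedBy (σ.corrE P false) ↑Mf := determinedBy_corrE hR false
  have fkg := triSitePercolation_locallyMonotone_fkg p hSP hSM hPM (σ.isUpperSet_armsE_true P) (σ.isLowerSet_armsE_false P)
    (σ.isUpperSet_corrE_true P) (σ.isLowerSet_corrE_false P) dAp dAm dBp dBm
  -- the corridor probabilities
  have hBp := real_corrE_ge hV hR p hrsw hρ hc hsp hcap hB true
  have hBm := real_corrE_ge hV hR p hrsw hρ hc hsp hcap hB false
  -- the move, and the rotation
  have hmove : σ.armsE P true ∩ σ.armsE P false ∩ (σ.corrE P true ∩ σ.corrE P false) ⊆ rotConfig (σ.r % 6) ⁻¹' extFourAdjR P.n (4 * P.M) := by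
    rintro ω ⟨⟨a0, a1⟩, b0, b1⟩
    exact readCfg_mem_extFourAdjR (move hV hR true a0 b0) (move hV hR false a1 b1)
  have hq0 : 0 ≤ (c ^ (B + 3)) ^ 2 := by positivity
  calc (triSitePercolation p).real (σ.armsE P true ∩ σ.armsE P false) * (c ^ (B + 3)) ^ 4
      = (triSitePercolation p).real (σ.armsE P true ∩ σ.armsE P false) * ((c ^ (B + 3)) ^ 2 * (c ^ (B + 3)) ^ 2) := by ring
    _ ≤ (triSitePercolation p).real (σ.armsE P true ∩ σ.armsE P false) *
          ((triSitePercolation p).real (σ.corrE P true) * (triSitePercolation p).real (σ.corrE P false)) :=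
        mul_le_mul_of_nonneg_left (mul_le_mul hBp hBm hq0 measureReal_nonneg) measureReal_nonneg
    _ ≤ (triSitePercolation p).real (σ.armsE P true ∩ σ.armsE P false ∩ (σ.corrE P true ∩ σ.corrE P false)) := fkg
    _ ≤ (triSitePercolation p).real (rotConfig (σ.r % 6) ⁻¹' extFourAdjR P.n (4 * P.M)) := measureReal_mono hmove (measure_ne_top _ _)
    _ = (triSitePercolation p).real (extFourAdjR P.n (4 * P.M)) := real_preimage_rotConfig _ _ _

end ASlot

/-- **The sum over routed slots**: for any finite set `S` of slots with the routing predicate,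
`P_p(⋃_{σ ∈ S} armsE true ∩ armsE false) · (c^(B+3))⁴ ≤ #S · P_p(extFourAdjR n (4M))`. [cite: Nolin2008, §4.4 (arXiv 0711.4948: proof of Thm. 10, p. 12), σ = BBWW] -/
theorem real_biUnion_armsE_le {P : OParams} (hV : P.ValidA) (p : unitInterval) {c : ℝ} {ρ Ncap B : ℕ}
    (hrsw : ∀ q : unitInterval, (q = p ∨ q = unitInterval.symm p) →
      ∀ n : ℕ, 1 ≤ ⌊(ρ : ℝ) * n⌋₊ → n ≤ Ncap → c ≤ triLRCrossingProb q ⌊(ρ : ℝ) * n⌋₊ n)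
    (hρ : 64 ≤ ρ) (hc : 0 ≤ c) (hsp : P.LL 7 ≤ ρ * (2 * P.ε)) (hcap : P.N' / 16 ≤ Ncap) (hB : P.GrA 7 ≤ B)
    (S : Finset ASlot) (hS : ∀ σ ∈ S, σ.RouteOK P) :
    (triSitePercolation p).real (⋃ σ ∈ S, σ.armsE P true ∩ σ.armsE P false) * (c ^ (B + 3)) ^ 4 ≤
      S.card * (triSitePercolation p).real (extFourAdjR P.n (4 * P.M)) := by
  classical
  set q := (c ^ (B + 3)) ^ 4 with hq
  set E := (triSitePercolation p).real (extFourAdjR P.n (4 * P.M)) with hE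
  have hq0 : 0 ≤ q := by positivity
  have hslot : ∀ σ ∈ S, (triSitePercolation p).real (σ.armsE P true ∩ σ.armsE P false) * q ≤ E := fun σ hσ =>
    ASlot.real_arms_le hV (hS σ hσ) p hrsw hρ hc hsp hcap hB
  calc (triSitePercolation p).real (⋃ σ ∈ S, σ.armsE P true ∩ σ.armsE P false) * q
      ≤ (∑ σ ∈ S, (triSitePercolation p).real (σ.armsE P true ∩ σ.armsE P false)) * q :=
        mul_le_mul_of_nonneg_right (measureReal_biUnion_finset_le _ _) hq0
    _ = ∑ σ ∈ S, (triSitePercolation p).real (σ.armsE P true ∩ σ.armsE P false) * q := Finset.sum_mul _ _ _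
    _ ≤ ∑ _σ ∈ S, E := Finset.sum_le_sum hslot
    _ = S.card * E := by rw [Finset.sum_const, nsmul_eq_mul]

end Literature.Probability.Percolation
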